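import Summits.Ventures.Crystal3D.Bulk.CapX2Cert
import Summits.Ventures.Crystal3D.Bulk.CapCutCheck
import HarnessLib

/-!
# X2 certificates: a kernel-evaluable check of inequality (I) (`Dtot ≤ M` on `[u₀, 1]`)

HONEST FRAMING. Venture `Summits/Ventures/Crystal3D` (cell `pub-crystal3d`, phase 2; seat p1).
Bookkeeping only, after p3's `Bulk/CapCutCheck.lean` (whose univariate polynomial arithmetic
`padd/pscale/pmul/ppow`, Taylor-form box test `checkCover` and GENERIC soundness theorem
`nonneg_of_checkCover` are reused verbatim): for an X2 certificate `c : X2Cert`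
(`Bulk/CapX2Cert.lean`) the singles polynomial
`Dtot(u) = K_p(u,u,1) + S11(1,1,1) + 2·S12(1,-u,-u) + S22(-u,-u,1)` is a univariate polynomial; this
file computes its coefficient list `dtotPoly c` INSIDE THE KERNEL from the certificate data and proves
`upolyEval (dtotPoly c) u = c.diagTot u`, using only
* `CapCert.kernel_diag` / `CapCut.eval_diagPoly` for `K_p(u,u,1) = Σ_k (1-u²)^k Σ_r g_{k,r}(u)²`;
* `Q3 k 1 v v = [k = 0]` (`Q3_one_left`: at the pole argument `A = 1` only the constant block
  survives) for `S11(1,1,1) = Σ_r a_{0,r}(1)²` and `S12(1,-u,-u) = Σ_r a_{0,r}(1) b_{0,r}(-u)`;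
* `Q3_diag` for `S22(-u,-u,1) = Σ_k (1-u²)^k Σ_r b_{k,r}(-u)²`.
Then `checkIneqIX2 c M pts := checkCover (M - dtotPoly c) u₀ pts 1` and the soundness theorem
`ineqI_of_checkX2 : checkIneqIX2 c M pts = true → c.IneqI M`. All arithmetic is structural recursion
on `ℚ` lists, so `decide +kernel` evaluates it with the standard axioms. Nothing about (II)/(III).
-/

open Finset
open Literature.Geometry.DiscreteGeometry Literature.Geometry.DiscreteGeometry.BachocVallentin
open Summit.Ventures.Crystal3D.CapCut

namespace Summit.Ventures.Crystal3D.CapX2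

/-! ### Two more list operations: sign flip and value at `1` -/

/-- Coefficient list of `u ↦ P(-u)`. -/
def pflip : List ℚ → List ℚ
  | [] => []
  | c :: p => c :: pscale (-1) (pflip p)

/-- `pflip` is the substitution `u ↦ -u`. -/
theorem eval_pflip (p : List ℚ) (u : ℝ) : upolyEval (pflip p) u = upolyEval p (-u) := by
  induction p with
  | nil => simp [pflip, upolyEval]
  | cons c p ih =>
    simp only [pflip, upolyEval, eval_pscale, ih, Rat.cast_neg, Rat.cast_one]; ring

/-- The value `P(1)` of a coefficient list, in `ℚ` (sum of the coefficients, Horner order). -/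
def qevalOne : List ℚ → ℚ
  | [] => 0
  | c :: p => c + qevalOne p

/-- `qevalOne` is evaluation at `1`. -/
theorem cast_qevalOne (p : List ℚ) : ((qevalOne p : ℚ) : ℝ) = upolyEval p 1 := by
  induction p with
  | nil => simp [qevalOne, upolyEval]
  | cons c p ih => simp only [qevalOne, upolyEval, Rat.cast_add, ih, one_mul]

/-- Structural `Σ_{i<n} f i` in `ℚ`. -/
def natSumQ (f : ℕ → ℚ) : ℕ → ℚ
  | 0 => 0
  | n + 1 => natSumQ f n + f n

/-- `natSumQ` is the range sum. -/
theorem cast_natSumQ (f : ℕ → ℚ) (n : ℕ) :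
    ((natSumQ f n : ℚ) : ℝ) = ∑ i ∈ range n, ((f i : ℚ) : ℝ) := by
  induction n with
  | zero => simp [natSumQ]
  | succ n ih => rw [natSumQ, Rat.cast_add, ih, Finset.sum_range_succ]

/-! ### The zonal factor at a pole argument -/

/-- At the pole value `A = 1` (the point `y = x`) with `B = C`: `Q3 k 1 v v = 1` for `k = 0` and
`0` for `k ≥ 1` (both Chebyshev arguments vanish). -/
theorem Q3_one_left (k : ℕ) (v : ℝ) : Q3 k 1 v v = if k = 0 then 1 else 0 := by
  unfold Q3
  have ha : (2 : ℝ) * (v - 1 * v) = 0 := by ring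
  have hw : ((1 : ℝ) - 1 ^ 2) * (1 - v ^ 2) = 0 := by ring
  rw [ha, hw]
  match k with
  | 0 => rfl
  | 1 => show (0 : ℝ) / 2 = _; simp
  | k + 2 =>
    show (0 : ℝ) * Literature.Analysis.SpecialFunctions.chebHom (k + 1) 0 0
      - 0 * Literature.Analysis.SpecialFunctions.chebHom k 0 0 = _
    simp

/-! ### The column polynomials of the X2 part -/

/-- Coefficient list of `a_{k,r}` restricted to the first `n` rows: `Σ_{i<n} M1_k[i][r] · g_{k,i}`. -/
def aPolyN (c : X2Cert) (k r : ℕ) : ℕ → List ℚ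
  | 0 => []
  | n + 1 => padd (aPolyN c k r n) (pscale (c.entry1 k n r) (c.basisX k n))

/-- Semantics of `aPolyN`. -/
theorem eval_aPolyN (c : X2Cert) (k r n : ℕ) (A : ℝ) :
    upolyEval (aPolyN c k r n) A =
      ∑ i ∈ range n, (c.entry1 k i r : ℝ) * upolyEval (c.basisX k i) A := by
  induction n with
  | zero => simp [aPolyN, upolyEval]
  | succ n ih => rw [aPolyN, eval_padd, eval_pscale, ih, Finset.sum_range_succ]

/-- `aPolyN` at full height is `a_{k,r}`. -/
theorem eval_aPolyN_rows (c : X2Cert) (k r : ℕ) (A : ℝ) :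
    upolyEval (aPolyN c k r (c.rowsX k)) A = c.a k r A := by
  rw [eval_aPolyN]; rfl

/-- Coefficient list of `b_{k,r}` restricted to the first `n` rows: `Σ_{i<n} M2_k[i][r] · g_{k,i}`. -/
def bPolyN (c : X2Cert) (k r : ℕ) : ℕ → List ℚ
  | 0 => []
  | n + 1 => padd (bPolyN c k r n) (pscale (c.entry2 k n r) (c.basisX k n))

/-- Semantics of `bPolyN`. -/
theorem eval_bPolyN (c : X2Cert) (k r n : ℕ) (A : ℝ) :
    upolyEval (bPolyN c k r n) A =
      ∑ i ∈ range n, (c.entry2 k i r : ℝ) * upolyEval (c.basisX k i) A := by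
  induction n with
  | zero => simp [bPolyN, upolyEval]
  | succ n ih => rw [bPolyN, eval_padd, eval_pscale, ih, Finset.sum_range_succ]

/-- `bPolyN` at full height is `b_{k,r}`. -/
theorem eval_bPolyN_rows (c : X2Cert) (k r : ℕ) (A : ℝ) :
    upolyEval (bPolyN c k r (c.rowsX k)) A = c.b k r A := by
  rw [eval_bPolyN]; rfl

/-- The column polynomial `a_{k,r}` (full height). -/
def aPoly (c : X2Cert) (k r : ℕ) : List ℚ := aPolyN c k r (c.rowsX k)

/-- The column polynomial `u ↦ b_{k,r}(-u)` (full height, flipped). -/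
def bPolyNeg (c : X2Cert) (k r : ℕ) : List ℚ := pflip (bPolyN c k r (c.rowsX k))

/-- Semantics of `aPoly` at `1`. -/
theorem cast_qevalOne_aPoly (c : X2Cert) (k r : ℕ) :
    ((qevalOne (aPoly c k r) : ℚ) : ℝ) = c.a k r 1 := by
  rw [cast_qevalOne, aPoly, eval_aPolyN_rows]

/-- Semantics of `bPolyNeg`. -/
theorem eval_bPolyNeg (c : X2Cert) (k r : ℕ) (u : ℝ) :
    upolyEval (bPolyNeg c k r) u = c.b k r (-u) := by
  rw [bPolyNeg, eval_pflip, eval_bPolyN_rows]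

/-! ### The three X2 pieces of the singles polynomial -/

/-- `S11(1,1,1) = Σ_{k<n} [k = 0] Σ_{r<RX} a_{k,r}(1)²`, in `ℚ`. -/
def s111N (c : X2Cert) (n : ℕ) : ℚ :=
  natSumQ (fun k => if k = 0 then natSumQ (fun r => qevalOne (aPoly c k r) ^ 2) c.RX else 0) n

/-- Semantics of `s111N`. -/
theorem cast_s111N (c : X2Cert) (n : ℕ) :
    ((s111N c n : ℚ) : ℝ) = ∑ k ∈ range n, ∑ r ∈ range c.RX, c.a k r 1 * c.a k r 1 * Q3 k 1 1 1 := by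
  rw [s111N, cast_natSumQ]
  refine Finset.sum_congr rfl fun k _ => ?_
  rw [Q3_one_left]
  split_ifs with hk
  · rw [cast_natSumQ]
    refine Finset.sum_congr rfl fun r _ => ?_
    rw [Rat.cast_pow, cast_qevalOne_aPoly]; ring
  · simp

/-- Coefficient list of `Σ_{r<n} a_{k,r}(1) · b_{k,r}(-u)`. -/
def s12BlockN (c : X2Cert) (k : ℕ) : ℕ → List ℚ
  | 0 => []
  | r + 1 => padd (s12BlockN c k r) (pscale (qevalOne (aPoly c k r)) (bPolyNeg c k r))

/-- Semantics of `s12BlockN`. -/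
theorem eval_s12BlockN (c : X2Cert) (k n : ℕ) (u : ℝ) :
    upolyEval (s12BlockN c k n) u = ∑ r ∈ range n, c.a k r 1 * c.b k r (-u) := by
  induction n with
  | zero => simp [s12BlockN, upolyEval]
  | succ n ih =>
    rw [s12BlockN, eval_padd, eval_pscale, ih, cast_qevalOne_aPoly, eval_bPolyNeg,
      Finset.sum_range_succ]

/-- Coefficient list of `S12(1,-u,-u) = Σ_{k<n} [k = 0] Σ_{r<RX} a_{k,r}(1) b_{k,r}(-u)`. -/
def s12PolyN (c : X2Cert) : ℕ → List ℚ
  | 0 => []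
  | k + 1 => padd (s12PolyN c k) (if k = 0 then s12BlockN c k c.RX else [])

/-- Semantics of `s12PolyN`. -/
theorem eval_s12PolyN (c : X2Cert) (n : ℕ) (u : ℝ) :
    upolyEval (s12PolyN c n) u =
      ∑ k ∈ range n, ∑ r ∈ range c.RX, c.a k r 1 * c.b k r (-u) * Q3 k 1 (-u) (-u) := by
  induction n with
  | zero => simp [s12PolyN, upolyEval]
  | succ n ih =>
    rw [s12PolyN, eval_padd, ih, Finset.sum_range_succ]
    congr 1
    rw [Q3_one_left]
    split_ifs with hk
    · rw [eval_s12BlockN]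
      refine Finset.sum_congr rfl fun r _ => ?_
      ring
    · simp [upolyEval]

/-- Coefficient list of `Σ_{r<n} b_{k,r}(-u)²`. -/
def s22BlockN (c : X2Cert) (k : ℕ) : ℕ → List ℚ
  | 0 => []
  | r + 1 => padd (s22BlockN c k r) (pmul (bPolyNeg c k r) (bPolyNeg c k r))

/-- Semantics of `s22BlockN`. -/
theorem eval_s22BlockN (c : X2Cert) (k n : ℕ) (u : ℝ) :
    upolyEval (s22BlockN c k n) u = ∑ r ∈ range n, c.b k r (-u) ^ 2 := by
  induction n with
  | zero => simp [s22BlockN, upolyEval]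
  | succ n ih => rw [s22BlockN, eval_padd, eval_pmul, ih, eval_bPolyNeg, Finset.sum_range_succ, sq]

/-- Coefficient list of `S22(-u,-u,1) = Σ_{k<n} (1-u²)^k Σ_{r<RX} b_{k,r}(-u)²`. -/
def s22PolyN (c : X2Cert) : ℕ → List ℚ
  | 0 => []
  | k + 1 => padd (s22PolyN c k) (pmul (ppow [1, 0, -1] k) (s22BlockN c k c.RX))

/-- Semantics of `s22PolyN`. -/
theorem eval_s22PolyN (c : X2Cert) (n : ℕ) (u : ℝ) :
    upolyEval (s22PolyN c n) u =
      ∑ k ∈ range n, ∑ r ∈ range c.RX, c.b k r (-u) * c.b k r (-u) * Q3 k (-u) (-u) 1 := by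
  induction n with
  | zero => simp [s22PolyN, upolyEval]
  | succ n ih =>
    rw [s22PolyN, eval_padd, eval_pmul, eval_ppow, ih, eval_s22BlockN, Finset.sum_range_succ]
    have h1 : upolyEval [1, 0, -1] u = 1 - (-u) ^ 2 := by
      simp [upolyEval]; ring
    rw [h1, ← Q3_diag, Finset.mul_sum]
    congr 1
    refine Finset.sum_congr rfl fun r _ => ?_
    ring

/-! ### The singles polynomial and the check -/

/-- THE SINGLES POLYNOMIAL of an X2 certificate: the coefficient list of
`u ↦ Dtot(u) = K_p(u,u,1) + S11(1,1,1) + 2·S12(1,-u,-u) + S22(-u,-u,1)`. -/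
def dtotPoly (c : X2Cert) : List ℚ :=
  padd (diagPoly c.cap)
    (padd [s111N c c.KX] (padd (pscale 2 (s12PolyN c c.KX)) (s22PolyN c c.KX)))

/-- `dtotPoly` evaluates to `Dtot`. -/
theorem eval_dtotPoly (c : X2Cert) (u : ℝ) : upolyEval (dtotPoly c) u = c.diagTot u := by
  rw [dtotPoly, eval_padd, eval_padd, eval_padd, eval_pscale, eval_diagPoly, eval_s12PolyN,
    eval_s22PolyN]
  have hc : upolyEval [s111N c c.KX] u = ((s111N c c.KX : ℚ) : ℝ) := by simp [upolyEval]
  rw [hc, cast_s111N]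
  unfold X2Cert.diagTot X2Cert.kernel X2Cert.S11 X2Cert.S12 X2Cert.S22 poleKernel3
  push_cast
  ring

/-- KERNEL CHECK of inequality (I) for an X2 certificate: `M - Dtot(u) ≥ 0` on `[u₀, 1]` by p3's
chained Taylor-form box test over the break points `pts`. -/
def checkIneqIX2 (c : X2Cert) (M : ℚ) (pts : List ℚ) : Bool :=
  checkCover (padd [M] (pscale (-1) (dtotPoly c))) c.u0 pts 1

/-- **Soundness of the X2 (I)-check**: a `true` run gives `c.IneqI M`. -/
theorem ineqI_of_checkX2 (c : X2Cert) (M : ℚ) (pts : List ℚ) (h : checkIneqIX2 c M pts = true) :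
    c.IneqI M := by
  intro u hu0 hu1
  have h0 := nonneg_of_checkCover _ pts c.u0 1 h u hu0 (by exact_mod_cast hu1)
  rw [eval_padd, eval_pscale, eval_dtotPoly] at h0
  simp [upolyEval] at h0
  linarith

/-! ### Symmetries of (II) and (III): the half / sorted domains suffice (for checkers) -/

/-- `P` is symmetric in `(u, v)` (the cap kernel is, `CapCut.kernel_swap`; the `S11` terms depend on `t`
only; the two `S12` terms are each other's mirror image). -/
theorem pairPoly_swap (c : X2Cert) (u v t : ℝ) : c.pairPoly u v t = c.pairPoly v u t := by
  unfold X2Cert.pairPoly X2Cert.kernel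
  rw [CapCut.kernel_swap]; ring

/-- **(II) from the half-domain `u ≤ v`** (what the cell's exact checkers cover, using the verified
`(u,v)`-symmetry of `P` to skip mirror boxes): it implies `c.IneqII s λ` on the full box. -/
theorem ineqII_of_half (c : X2Cert) (s lam : ℚ)
    (h : ∀ u v t : ℝ, (c.u0 : ℝ) ≤ u → u ≤ v → v ≤ 1 → -1 ≤ t → t ≤ s →
      0 ≤ 1 + 2 * u * v * t - u ^ 2 - v ^ 2 - t ^ 2 → c.pairPoly u v t ≤ -lam) :
    c.IneqII s lam := by
  intro u v t hu0 hu1 hv0 hv1 ht1 hts hg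
  rcases le_total u v with huv | hvu
  · exact h u v t hu0 huv hv1 ht1 hts hg
  · rw [pairPoly_swap]
    exact h v u t hv0 hvu hu1 ht1 hts (by linarith [hg])

/-- `S11` is symmetric in its first two arguments. -/
theorem S11_swap (c : X2Cert) (A B C : ℝ) : c.S11 A B C = c.S11 B A C := by
  unfold X2Cert.S11; rw [poleKernel3_swap]

/-- `S₃` is invariant under swapping its first two arguments. -/
theorem tripleSym_swap12 (c : X2Cert) (a' b' c' : ℝ) :
    c.tripleSym a' b' c' = c.tripleSym b' a' c' := by
  unfold X2Cert.tripleSym; rw [S11_swap c a' b' c']; ring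

/-- `S₃` is invariant under swapping its last two arguments. -/
theorem tripleSym_swap23 (c : X2Cert) (a' b' c' : ℝ) :
    c.tripleSym a' b' c' = c.tripleSym a' c' b' := by
  unfold X2Cert.tripleSym; rw [S11_swap c b' c' a']; ring

/-- **(III) from the sorted domain `a ≤ b ≤ c`** (the cell's checkers split `R₃` into root boxes
with sorted indices, using the verified `S₃`-symmetry): it implies `c.IneqIII s ε₃` on the full cube. -/
theorem ineqIII_of_sorted (c : X2Cert) (s eps3 : ℚ)
    (h : ∀ a' b' c' : ℝ, -1 ≤ a' → a' ≤ b' → b' ≤ c' → c' ≤ s →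
      0 ≤ 1 + 2 * a' * b' * c' - a' ^ 2 - b' ^ 2 - c' ^ 2 → c.tripleSym a' b' c' ≤ eps3) :
    c.IneqIII s eps3 := by
  intro a' b' c' ha1 has hb1 hbs hc1 hcs hg
  -- sort the three arguments using the two transpositions (8 sign patterns of `le_total`)
  rcases le_total a' b' with hab | hba <;> rcases le_total b' c' with hbc | hcb <;>
    rcases le_total a' c' with hac | hca
  · exact h a' b' c' ha1 hab hbc hcs hg
  · exact h a' b' c' ha1 hab hbc hcs hg
  · rw [tripleSym_swap23]
    exact h a' c' b' ha1 hac hcb hbs (by linarith [hg])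
  · rw [tripleSym_swap23, tripleSym_swap12]
    exact h c' a' b' hc1 hca hab hbs (by linarith [hg])
  · rw [tripleSym_swap12]
    exact h b' a' c' hb1 hba hac hcs (by linarith [hg])
  · rw [tripleSym_swap12, tripleSym_swap23]
    exact h b' c' a' hb1 hbc hca has (by linarith [hg])
  · rw [tripleSym_swap12, tripleSym_swap23, tripleSym_swap12]
    exact h c' b' a' hc1 hcb hba has (by linarith [hg])
  · rw [tripleSym_swap12, tripleSym_swap23, tripleSym_swap12]
    exact h c' b' a' hc1 hcb hba has (by linarith [hg])

end Summit.Ventures.Crystal3D.CapX2
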